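import Mathlib
import HarnessLib
import Summits.HubbardSuperconductivity.HubbardSuperconductivity.Theorems.KLProgrammeKLRegimeEnginePairTransferDLineEdgeTwoShell

/-!
# Route `KLProgramme` — ENGINE item stmt-HubbardSuperconductivity-20437 `KLRegimeEngineV17F2`, class-#5 STEP (X).3: the `D`-rows `WDd / WDx` IN THE ROOM's CURRENCY
# for EVERY pair `n + 1 ≤ j′ ≤ j` — EDGE `j′ = n + 1` INCLUDED — in the TAIL regime `Λₙ₊₁ ≤ c·G·|transfer|_𝕋` (`1 ≤ c`; the consumer's `c = 8` gives `2048·G²`, `c = 16` gives `8192·G²`)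
# (cell gate-hubbard-kl, seat hubbard-kl-k3c2-p2 g20; located item «(X).3-D-EDGE» of k3c1-p1 g16, CLASS5-RESOLVED-STEP.md §13 (3); reading of `…DLineEdgeTwoShell`)

WHY.  `…DLineEdgeTwoShell` gives the two-shell law for the `D`-line masses of every pair `n + 1 ≤ j′ ≤ j` with the partner shell read at `Λₙ`.  This file is the
slots reading (the arithmetic of gen 16's `…DLineRoomReading` with `κ = 4c`, i.e. `2κ²G² = 32c²·G²`, since above the threshold `Λₙ = 4Λₙ₊₁ ≤ 4c·G·r`):
* **`WDd_edge_row_le_slots`** — `n + 1 ≤ j′ ≤ j`, `π/(4β) ≤ Λ_{j′}`, `t ∈ [0,1]`, `Gδ ≤ Λₙ₊₁`, `Λₙ + Gδ ≤ klE0`, `1 ≤ c`, `Λₙ₊₁ ≤ c·G·|x − y|_𝕋`: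
  `(Λₙ−Λₙ₊₁)((βL²)³)⁻¹·WDd(t,x,y) ≤ (512/3)(27/(8π²))·A·(16Λ_{j′}/Λₙ)/π·(10 + 50Gβ/L)·(32c²·G²·min(|x−y|_𝕋/Λₙ₊₁, Λₙ₊₁/|x−y|_𝕋) + 2⁻ⁿ/4)`;
* **`WDx_edge_row_le_slots`** — the crossed twin at transfer `x + y − Q_m` (`256/3`; no `16π/β ≤ Λₙ₊₁` needed);
* `sixteen_mul_klScale_succ_div` (`16Λₙ₊₁/Λₙ = 4`: the edge prefactor `K′ = K/4`), `…_klTS` package instances.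
BELOW the threshold at the edge see the module docstring of `…DLineEdgeTwoShell` («(X).3-D-EDGE-FORWARD»: signed rows, not a sign-blind slot row).
Pure real arithmetic over the companion; nothing about the model's kernel sizes is asserted; nothing asserts (X).3, (c), K3 or superconductivity.  0 kit · 0 lit.
-/

noncomputable section

namespace Summit.HubbardSuperconductivity.HubbardSuperconductivity.Theorems.KLRegimeSplit

set_option linter.dupNamespace false -- summit = problem name (single-conjunct summit), D-0017

open Real Finset Set Literature.MathematicalPhysics.QuantumLattice Literature.Probability.LatticeModels
open Literature.MathematicalPhysics.QuantumLattice.FermiRG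
open Summit.HubbardSuperconductivity.HubbardSuperconductivity.Theorems.KLProgrammeLegKernels
open Summit.HubbardSuperconductivity.HubbardSuperconductivity.Theorems.TwoPointAssembly
open Summit.HubbardSuperconductivity.HubbardSuperconductivity.Theorems.DispersionFlow
open Summit.HubbardSuperconductivity.HubbardSuperconductivity.Theorems.KLRegimeWick
open Summit.HubbardSuperconductivity.HubbardSuperconductivity.Theorems.EngineV8

variable {L M : ℕ} (β μ : ℝ) (K : TrigPolyC4v)

/-! ## §3 The `D`-rows in the ROOM's currency above the leg-transfer threshold, every `n + 1 ≤ j′ ≤ j` -/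

/-- **THE DIRECT `D`-ROW IN THE SLOTS' CURRENCY, EVERY PAIR `n + 1 ≤ j′ ≤ j`, TAIL REGIME `Λₙ₊₁ ≤ c·G·|x − y|_𝕋` (`1 ≤ c`).**  `π/(4β) ≤ Λ_{j′}`,
`t ∈ [0,1]`, `Gδ ≤ Λₙ₊₁`, `Λₙ + Gδ ≤ klE0` (`G = 4 + (8/3)Gfr₁U²`, `δ = 2π/L`):
`(Λₙ−Λₙ₊₁)·((βL²)³)⁻¹·WDd(t,x,y) ≤ (512/3)(27/(8π²))·A·(16·Λ_{j′}/Λₙ)/π·(10 + 50Gβ/L)·(32c²·G²·min(|x−y|_𝕋/Λₙ₊₁, Λₙ₊₁/|x−y|_𝕋) + 2⁻ⁿ/4)`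
— the interior row `WDd_row_le_slots` with `32c² = 2·(4c)²` for `72 = 2·6²`, valid AT THE EDGE `j′ = n+1` (`Λ_{j′}/Λₙ = 1/4`); `c = 8 ↦ 2048`, `c = 16 ↦ 8192`. -/
theorem WDd_edge_row_le_slots [NeZero L] [NeZero M] {A : ℝ} {u : RenConsts → ℝ} (h : TwoShellFrameAreaAt A u)
    (hA : 0 ≤ A) {R : RenConsts} (hR : R.WF2) {U : ℝ} (hU : 0 < U) (hUu : U ≤ u R) (hμ : μ ∈ klWindowC) {N : ℕ} (hK : FrameOK R U N μ K)
    (hβ : 0 < β) (n : ℕ) {j j' : ℕ} (hj' : n + 1 ≤ j') (hjj : j' ≤ j) (hj'β : π / (4 * β) ≤ klScale klE0 j') {t : ℝ} (ht : t ∈ Icc (0 : ℝ) 1)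
    (hGδ : (4 + 8 / 3 * R.Gfr 1 * U ^ 2) * (2 * π / L) ≤ klScale klE0 (n + 1))
    (hE0 : klScale klE0 n + (4 + 8 / 3 * R.Gfr 1 * U ^ 2) * (2 * π / L) ≤ klE0) (x y : TorusSite 2 L)
    {c : ℝ} (hc : 1 ≤ c) (htail : klScale klE0 (n + 1) ≤ c * ((4 + 8 / 3 * R.Gfr 1 * U ^ 2) * klTorusNorm L (x - y))) :
    (klScale klE0 n - klScale klE0 (n + 1)) * ((β * (L : ℝ) ^ 2) ^ 3)⁻¹ *
      ∑ p : FreqMomentum L M, ∑ _σ : Fin 2, ∑ p' : FreqMomentum L M,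
        (if matsubaraInt M p'.1 + matsubaraInt M (omega0 M) = matsubaraInt M p.1 + matsubaraInt M (omega0 M) ∧ p'.2 = p.2 + x - y then
          ‖((((softSymbolCompl L M β μ K (n + 1) j p - softSymbolCompl L M β μ K (n + 1) j' p : ℝ)) : ℂ) * (((β * (L : ℝ) ^ 2 : ℝ) : ℂ) * propCT L M β μ K p)) *
              ((((deriv (fun Λ' : ℝ => hubbardCutoffWeightCT L M β μ K Λ' p') (klScale klE0 n + t * (klScale klE0 (n + 1) - klScale klE0 n)) : ℝ)) : ℂ) *
                (((β * (L : ℝ) ^ 2 : ℝ) : ℂ) * propCT L M β μ K p')) +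
            ((((deriv (fun Λ' : ℝ => hubbardCutoffWeightCT L M β μ K Λ' p) (klScale klE0 n + t * (klScale klE0 (n + 1) - klScale klE0 n)) : ℝ)) : ℂ) *
                (((β * (L : ℝ) ^ 2 : ℝ) : ℂ) * propCT L M β μ K p)) *
              ((((softSymbolCompl L M β μ K (n + 1) j p' - softSymbolCompl L M β μ K (n + 1) j' p' : ℝ)) : ℂ) * (((β * (L : ℝ) ^ 2 : ℝ) : ℂ) * propCT L M β μ K p'))‖
        else 0) ≤
      512 / 3 * (27 / (8 * π ^ 2)) * A * (16 * (klScale klE0 j' / klScale klE0 n)) / π * (10 + 50 * (4 + 8 / 3 * R.Gfr 1 * U ^ 2) * β / L) *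
        (32 * c ^ 2 * (4 + 8 / 3 * R.Gfr 1 * U ^ 2) ^ 2 * min (klTorusNorm L (x - y) / klScale klE0 (n + 1)) (klScale klE0 (n + 1) / klTorusNorm L (x - y)) +
          ((2 : ℝ) ^ n)⁻¹ / 4) := by
  have hπ := Real.pi_pos
  have hL : (0 : ℝ) < L := by exact_mod_cast Nat.pos_of_ne_zero (NeZero.ne L)
  have hGfr : ∀ j, 0 ≤ R.Gfr j := hR.wf.2.2
  set G : ℝ := 4 + 8 / 3 * R.Gfr 1 * U ^ 2 with hG
  have hG4 : 4 ≤ G := by rw [hG]; nlinarith [hGfr 1, sq_nonneg U]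
  have hG0 : 0 ≤ G := by linarith
  set Λ : ℝ := klScale klE0 n + t * (klScale klE0 (n + 1) - klScale klE0 n) with hΛdef
  have hΛ : 0 < Λ := scaleAt_pos n ht
  obtain ⟨hΛlo, hΛhi⟩ := scaleAt_mem n ht
  rw [← hΛdef] at hΛlo hΛhi
  have hΛn := klth_klScale_pos n
  have hΛ1 := klth_klScale_pos (n + 1)
  have hΛj := klth_klScale_pos j'
  have hsucc : klScale klE0 (n + 1) = klScale klE0 n / 4 := klth_klScale_succ n
  set r : ℝ := klTorusNorm L (x - y) with hr
  have hr0 : 0 ≤ r := by rw [hr]; unfold klTorusNorm KLProgrammeLegKernels.torusSupNorm torusAbs; positivity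
  set mn : ℝ := min (r / klScale klE0 (n + 1)) (klScale klE0 (n + 1) / r) with hmn
  have hmn0 : 0 ≤ mn := le_min (by positivity) (by positivity)
  have hrpos : 0 < r := by
    by_contra h0; push Not at h0
    have h1 : G * r ≤ 0 := mul_nonpos_of_nonneg_of_nonpos hG0 h0
    have h2 : c * (G * r) ≤ 0 := mul_nonpos_of_nonneg_of_nonpos (by linarith) h1
    linarith
  have hbound := WDd_sum_le_twoShell_edge (L := L) (M := M) β μ K h hA hR hU hUu hμ hK hβ n hj' hjj ht hE0 hrpos (le_refl r)
  rw [← hΛdef] at hbound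
  -- the slots reading of the two-shell factor at the partner shell `Λₙ = 4Λₙ₊₁` (`κ = 32`) and of the bracket
  have hc0 : 0 < c := by linarith
  have hthr : klScale klE0 n / (4 * c) ≤ G * r := by
    rw [div_le_iff₀ (by positivity)]
    rw [hsucc] at htail
    have : klScale klE0 n ≤ 4 * (c * (G * r)) := by linarith
    linarith
  have hX := twoShell_factor_le_slots (Λ := klScale klE0 n) (e := G * (2 * π / L)) (κ := 4 * c) hΛ1 (by rw [hsucc]; linarith) (by rw [hsucc]; linarith) hG4
    (by linarith) hthr (hGδ.trans (by rw [hsucc]; linarith))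
  have hX' : (klScale klE0 n + G * (2 * π / L)) / r + Real.sqrt (klScale klE0 n + G * (2 * π / L)) ≤ 32 * c ^ 2 * G ^ 2 * mn + ((2 : ℝ) ^ n)⁻¹ / 4 := by
    refine hX.trans (add_le_add (le_of_eq (by rw [hmn]; ring)) (le_of_eq (sqrt_two_mul_klScale_eq n)))
  have hB := bracket_le (Λ' := klScale klE0 j') hβ hL hG0 hj'β
  have hXnn : 0 ≤ (klScale klE0 n + G * (2 * π / L)) / r + Real.sqrt (klScale klE0 n + G * (2 * π / L)) := by positivity
  have hBnn : 0 ≤ β * klScale klE0 j' / π * (10 + 2 * G * β / L) + 12 * G * β / L := by positivity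
  -- multiply out
  have hpre : 0 ≤ (klScale klE0 n - klScale klE0 (n + 1)) * ((β * (L : ℝ) ^ 2) ^ 3)⁻¹ := by
    rw [hsucc]; have : 0 ≤ klScale klE0 n - klScale klE0 n / 4 := by linarith
    positivity
  refine (mul_le_mul_of_nonneg_left hbound hpre).trans ?_
  rw [hsucc, prefactor_eq hβ hL hΛ]
  -- compare factor by factor
  have hratio : klScale klE0 n / (β * Λ ^ 2) * (β * klScale klE0 j' / π) ≤ 16 * (klScale klE0 j' / klScale klE0 n) / π :=
    ratio_le_sixteen hΛn hΛj hβ hΛ (by rw [hsucc] at hΛlo; exact hΛlo)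
  calc 512 / 3 * (27 / (8 * π ^ 2)) * A * (klScale klE0 n / (β * Λ ^ 2)) *
        ((klScale klE0 n + G * (2 * π / L)) / r + Real.sqrt (klScale klE0 n + G * (2 * π / L))) *
        (β * klScale klE0 j' / π * (10 + 2 * G * β / L) + 12 * G * β / L)
      ≤ 512 / 3 * (27 / (8 * π ^ 2)) * A * (klScale klE0 n / (β * Λ ^ 2)) * (32 * c ^ 2 * G ^ 2 * mn + ((2 : ℝ) ^ n)⁻¹ / 4) *
        (β * klScale klE0 j' / π * (10 + 50 * G * β / L)) := by gcongr
    _ = 512 / 3 * (27 / (8 * π ^ 2)) * A * (klScale klE0 n / (β * Λ ^ 2) * (β * klScale klE0 j' / π)) * (10 + 50 * G * β / L) *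
        (32 * c ^ 2 * G ^ 2 * mn + ((2 : ℝ) ^ n)⁻¹ / 4) := by ring
    _ ≤ 512 / 3 * (27 / (8 * π ^ 2)) * A * (16 * (klScale klE0 j' / klScale klE0 n) / π) * (10 + 50 * G * β / L) *
        (32 * c ^ 2 * G ^ 2 * mn + ((2 : ℝ) ^ n)⁻¹ / 4) := by gcongr
    _ = _ := by ring

/-- **THE CROSSED `D`-ROW IN THE SLOTS' CURRENCY, EVERY PAIR `n + 1 ≤ j′ ≤ j`, TAIL REGIME `Λₙ₊₁ ≤ c·G·|x + y − Q_m|_𝕋`** (`1 ≤ c`; twin of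
`WDd_edge_row_le_slots` at transfer `x + y − Q_m`, half the prefactor; NO `16π/β ≤ Λₙ₊₁` needed). -/
theorem WDx_edge_row_le_slots [NeZero L] [NeZero M] {A : ℝ} {u : RenConsts → ℝ} (h : TwoShellFrameAreaAt A u)
    (hA : 0 ≤ A) {R : RenConsts} (hR : R.WF2) {U : ℝ} (hU : 0 < U) (hUu : U ≤ u R) (hμ : μ ∈ klWindowC) {N : ℕ} (hK : FrameOK R U N μ K)
    (hβ : 0 < β) (n : ℕ) {j j' : ℕ} (hj' : n + 1 ≤ j') (hjj : j' ≤ j) (hj'β : π / (4 * β) ≤ klScale klE0 j') {t : ℝ} (ht : t ∈ Icc (0 : ℝ) 1)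
    (hGδ : (4 + 8 / 3 * R.Gfr 1 * U ^ 2) * (2 * π / L) ≤ klScale klE0 (n + 1))
    (hE0 : klScale klE0 n + (4 + 8 / 3 * R.Gfr 1 * U ^ 2) * (2 * π / L) ≤ klE0) (Qm x y : TorusSite 2 L)
    {c : ℝ} (hc : 1 ≤ c) (htail : klScale klE0 (n + 1) ≤ c * ((4 + 8 / 3 * R.Gfr 1 * U ^ 2) * klTorusNorm L (x + y - Qm))) :
    (klScale klE0 n - klScale klE0 (n + 1)) * ((β * (L : ℝ) ^ 2) ^ 3)⁻¹ *
      ∑ p : FreqMomentum L M, ∑ p' : FreqMomentum L M,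
        (if matsubaraInt M p'.1 + matsubaraInt M (omega0 M) + matsubaraInt M (omega0 M) + 1 = matsubaraInt M p.1 ∧ p'.2 = p.2 + Qm - x - y then
          ‖((((softSymbolCompl L M β μ K (n + 1) j p - softSymbolCompl L M β μ K (n + 1) j' p : ℝ)) : ℂ) * (((β * (L : ℝ) ^ 2 : ℝ) : ℂ) * propCT L M β μ K p)) *
              ((((deriv (fun Λ' : ℝ => hubbardCutoffWeightCT L M β μ K Λ' p') (klScale klE0 n + t * (klScale klE0 (n + 1) - klScale klE0 n)) : ℝ)) : ℂ) *
                (((β * (L : ℝ) ^ 2 : ℝ) : ℂ) * propCT L M β μ K p')) +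
            ((((deriv (fun Λ' : ℝ => hubbardCutoffWeightCT L M β μ K Λ' p) (klScale klE0 n + t * (klScale klE0 (n + 1) - klScale klE0 n)) : ℝ)) : ℂ) *
                (((β * (L : ℝ) ^ 2 : ℝ) : ℂ) * propCT L M β μ K p)) *
              ((((softSymbolCompl L M β μ K (n + 1) j p' - softSymbolCompl L M β μ K (n + 1) j' p' : ℝ)) : ℂ) * (((β * (L : ℝ) ^ 2 : ℝ) : ℂ) * propCT L M β μ K p'))‖
        else 0) ≤
      256 / 3 * (27 / (8 * π ^ 2)) * A * (16 * (klScale klE0 j' / klScale klE0 n)) / π * (10 + 50 * (4 + 8 / 3 * R.Gfr 1 * U ^ 2) * β / L) *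
        (32 * c ^ 2 * (4 + 8 / 3 * R.Gfr 1 * U ^ 2) ^ 2 * min (klTorusNorm L (x + y - Qm) / klScale klE0 (n + 1)) (klScale klE0 (n + 1) / klTorusNorm L (x + y - Qm)) +
          ((2 : ℝ) ^ n)⁻¹ / 4) := by
  have hπ := Real.pi_pos
  have hL : (0 : ℝ) < L := by exact_mod_cast Nat.pos_of_ne_zero (NeZero.ne L)
  have hGfr : ∀ j, 0 ≤ R.Gfr j := hR.wf.2.2
  set G : ℝ := 4 + 8 / 3 * R.Gfr 1 * U ^ 2 with hG
  have hG4 : 4 ≤ G := by rw [hG]; nlinarith [hGfr 1, sq_nonneg U]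
  have hG0 : 0 ≤ G := by linarith
  set Λ : ℝ := klScale klE0 n + t * (klScale klE0 (n + 1) - klScale klE0 n) with hΛdef
  have hΛ : 0 < Λ := scaleAt_pos n ht
  obtain ⟨hΛlo, hΛhi⟩ := scaleAt_mem n ht
  rw [← hΛdef] at hΛlo hΛhi
  have hΛn := klth_klScale_pos n
  have hΛ1 := klth_klScale_pos (n + 1)
  have hΛj := klth_klScale_pos j'
  have hsucc : klScale klE0 (n + 1) = klScale klE0 n / 4 := klth_klScale_succ n
  set r : ℝ := klTorusNorm L (x + y - Qm) with hr
  have hr0 : 0 ≤ r := by rw [hr]; unfold klTorusNorm KLProgrammeLegKernels.torusSupNorm torusAbs; positivity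
  set mn : ℝ := min (r / klScale klE0 (n + 1)) (klScale klE0 (n + 1) / r) with hmn
  have hmn0 : 0 ≤ mn := le_min (by positivity) (by positivity)
  have hrpos : 0 < r := by
    by_contra h0; push Not at h0
    have h1 : G * r ≤ 0 := mul_nonpos_of_nonneg_of_nonpos hG0 h0
    have h2 : c * (G * r) ≤ 0 := mul_nonpos_of_nonneg_of_nonpos (by linarith) h1
    linarith
  have hbound := WDx_sum_le_twoShell_edge (L := L) (M := M) β μ K h hA hR hU hUu hμ hK hβ n hj' hjj ht hE0 hrpos (le_refl r)
  rw [← hΛdef] at hbound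
  have hc0 : 0 < c := by linarith
  have hthr : klScale klE0 n / (4 * c) ≤ G * r := by
    rw [div_le_iff₀ (by positivity)]
    rw [hsucc] at htail
    have : klScale klE0 n ≤ 4 * (c * (G * r)) := by linarith
    linarith
  have hX := twoShell_factor_le_slots (Λ := klScale klE0 n) (e := G * (2 * π / L)) (κ := 4 * c) hΛ1 (by rw [hsucc]; linarith) (by rw [hsucc]; linarith) hG4
    (by linarith) hthr (hGδ.trans (by rw [hsucc]; linarith))
  have hX' : (klScale klE0 n + G * (2 * π / L)) / r + Real.sqrt (klScale klE0 n + G * (2 * π / L)) ≤ 32 * c ^ 2 * G ^ 2 * mn + ((2 : ℝ) ^ n)⁻¹ / 4 := by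
    refine hX.trans (add_le_add (le_of_eq (by rw [hmn]; ring)) (le_of_eq (sqrt_two_mul_klScale_eq n)))
  have hB := bracket_le (Λ' := klScale klE0 j') hβ hL hG0 hj'β
  have hXnn : 0 ≤ (klScale klE0 n + G * (2 * π / L)) / r + Real.sqrt (klScale klE0 n + G * (2 * π / L)) := by positivity
  have hBnn : 0 ≤ β * klScale klE0 j' / π * (10 + 2 * G * β / L) + 12 * G * β / L := by positivity
  have hpre : 0 ≤ (klScale klE0 n - klScale klE0 (n + 1)) * ((β * (L : ℝ) ^ 2) ^ 3)⁻¹ := by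
    rw [hsucc]; have : 0 ≤ klScale klE0 n - klScale klE0 n / 4 := by linarith
    positivity
  refine (mul_le_mul_of_nonneg_left hbound hpre).trans ?_
  rw [hsucc, prefactor_eq hβ hL hΛ]
  have hratio : klScale klE0 n / (β * Λ ^ 2) * (β * klScale klE0 j' / π) ≤ 16 * (klScale klE0 j' / klScale klE0 n) / π :=
    ratio_le_sixteen hΛn hΛj hβ hΛ (by rw [hsucc] at hΛlo; exact hΛlo)
  calc 256 / 3 * (27 / (8 * π ^ 2)) * A * (klScale klE0 n / (β * Λ ^ 2)) *
        ((klScale klE0 n + G * (2 * π / L)) / r + Real.sqrt (klScale klE0 n + G * (2 * π / L))) *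
        (β * klScale klE0 j' / π * (10 + 2 * G * β / L) + 12 * G * β / L)
      ≤ 256 / 3 * (27 / (8 * π ^ 2)) * A * (klScale klE0 n / (β * Λ ^ 2)) * (32 * c ^ 2 * G ^ 2 * mn + ((2 : ℝ) ^ n)⁻¹ / 4) *
        (β * klScale klE0 j' / π * (10 + 50 * G * β / L)) := by gcongr
    _ = 256 / 3 * (27 / (8 * π ^ 2)) * A * (klScale klE0 n / (β * Λ ^ 2) * (β * klScale klE0 j' / π)) * (10 + 50 * G * β / L) *
        (32 * c ^ 2 * G ^ 2 * mn + ((2 : ℝ) ^ n)⁻¹ / 4) := by ring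
    _ ≤ 256 / 3 * (27 / (8 * π ^ 2)) * A * (16 * (klScale klE0 j' / klScale klE0 n) / π) * (10 + 50 * G * β / L) *
        (32 * c ^ 2 * G ^ 2 * mn + ((2 : ℝ) ^ n)⁻¹ / 4) := by gcongr
    _ = _ := by ring

/-! ## §4 The edge readings: `Λ_{n+1}/Λₙ = 1/4`, and the package instances -/

omit K μ β in
/-- At the edge `j′ = n+1` the index prefactor is `16·Λₙ₊₁/Λₙ = 4` (`K′ = K/4` of the located item). -/
theorem sixteen_mul_klScale_succ_div (n : ℕ) : 16 * (klScale klE0 (n + 1) / klScale klE0 n) = 4 := by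
  rw [klth_klScale_succ]
  have h := (klth_klScale_pos n).ne'
  field_simp
  ring

/-- **The package instance of the direct edge/tail row** (`A = klTS`, `u = klTSU`). -/
theorem WDd_edge_row_le_slots_klTS [NeZero L] [NeZero M] {R : RenConsts} (hR : R.WF2) {U : ℝ} (hU : 0 < U) (hUu : U ≤ klTSU R)
    (hμ : μ ∈ klWindowC) {N : ℕ} (hK : FrameOK R U N μ K) (hβ : 0 < β) (n : ℕ) {j j' : ℕ} (hj' : n + 1 ≤ j') (hjj : j' ≤ j)
    (hj'β : π / (4 * β) ≤ klScale klE0 j') {t : ℝ} (ht : t ∈ Icc (0 : ℝ) 1)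
    (hGδ : (4 + 8 / 3 * R.Gfr 1 * U ^ 2) * (2 * π / L) ≤ klScale klE0 (n + 1))
    (hE0 : klScale klE0 n + (4 + 8 / 3 * R.Gfr 1 * U ^ 2) * (2 * π / L) ≤ klE0) (x y : TorusSite 2 L)
    {c : ℝ} (hc : 1 ≤ c) (htail : klScale klE0 (n + 1) ≤ c * ((4 + 8 / 3 * R.Gfr 1 * U ^ 2) * klTorusNorm L (x - y))) :
    (klScale klE0 n - klScale klE0 (n + 1)) * ((β * (L : ℝ) ^ 2) ^ 3)⁻¹ *
      ∑ p : FreqMomentum L M, ∑ _σ : Fin 2, ∑ p' : FreqMomentum L M,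
        (if matsubaraInt M p'.1 + matsubaraInt M (omega0 M) = matsubaraInt M p.1 + matsubaraInt M (omega0 M) ∧ p'.2 = p.2 + x - y then
          ‖((((softSymbolCompl L M β μ K (n + 1) j p - softSymbolCompl L M β μ K (n + 1) j' p : ℝ)) : ℂ) * (((β * (L : ℝ) ^ 2 : ℝ) : ℂ) * propCT L M β μ K p)) *
              ((((deriv (fun Λ' : ℝ => hubbardCutoffWeightCT L M β μ K Λ' p') (klScale klE0 n + t * (klScale klE0 (n + 1) - klScale klE0 n)) : ℝ)) : ℂ) *
                (((β * (L : ℝ) ^ 2 : ℝ) : ℂ) * propCT L M β μ K p')) +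
            ((((deriv (fun Λ' : ℝ => hubbardCutoffWeightCT L M β μ K Λ' p) (klScale klE0 n + t * (klScale klE0 (n + 1) - klScale klE0 n)) : ℝ)) : ℂ) *
                (((β * (L : ℝ) ^ 2 : ℝ) : ℂ) * propCT L M β μ K p)) *
              ((((softSymbolCompl L M β μ K (n + 1) j p' - softSymbolCompl L M β μ K (n + 1) j' p' : ℝ)) : ℂ) * (((β * (L : ℝ) ^ 2 : ℝ) : ℂ) * propCT L M β μ K p'))‖
        else 0) ≤
      512 / 3 * (27 / (8 * π ^ 2)) * klTS * (16 * (klScale klE0 j' / klScale klE0 n)) / π * (10 + 50 * (4 + 8 / 3 * R.Gfr 1 * U ^ 2) * β / L) *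
        (32 * c ^ 2 * (4 + 8 / 3 * R.Gfr 1 * U ^ 2) ^ 2 * min (klTorusNorm L (x - y) / klScale klE0 (n + 1)) (klScale klE0 (n + 1) / klTorusNorm L (x - y)) +
          ((2 : ℝ) ^ n)⁻¹ / 4) :=
  WDd_edge_row_le_slots β μ K twoShellFrameAreaAt_klTS klTS_nonneg hR hU hUu hμ hK hβ n hj' hjj hj'β ht hGδ hE0 x y hc htail

/-- **The package instance of the crossed edge/tail row** (`A = klTS`, `u = klTSU`). -/
theorem WDx_edge_row_le_slots_klTS [NeZero L] [NeZero M] {R : RenConsts} (hR : R.WF2) {U : ℝ} (hU : 0 < U) (hUu : U ≤ klTSU R)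
    (hμ : μ ∈ klWindowC) {N : ℕ} (hK : FrameOK R U N μ K) (hβ : 0 < β) (n : ℕ) {j j' : ℕ} (hj' : n + 1 ≤ j') (hjj : j' ≤ j)
    (hj'β : π / (4 * β) ≤ klScale klE0 j') {t : ℝ} (ht : t ∈ Icc (0 : ℝ) 1)
    (hGδ : (4 + 8 / 3 * R.Gfr 1 * U ^ 2) * (2 * π / L) ≤ klScale klE0 (n + 1))
    (hE0 : klScale klE0 n + (4 + 8 / 3 * R.Gfr 1 * U ^ 2) * (2 * π / L) ≤ klE0) (Qm x y : TorusSite 2 L)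
    {c : ℝ} (hc : 1 ≤ c) (htail : klScale klE0 (n + 1) ≤ c * ((4 + 8 / 3 * R.Gfr 1 * U ^ 2) * klTorusNorm L (x + y - Qm))) :
    (klScale klE0 n - klScale klE0 (n + 1)) * ((β * (L : ℝ) ^ 2) ^ 3)⁻¹ *
      ∑ p : FreqMomentum L M, ∑ p' : FreqMomentum L M,
        (if matsubaraInt M p'.1 + matsubaraInt M (omega0 M) + matsubaraInt M (omega0 M) + 1 = matsubaraInt M p.1 ∧ p'.2 = p.2 + Qm - x - y then
          ‖((((softSymbolCompl L M β μ K (n + 1) j p - softSymbolCompl L M β μ K (n + 1) j' p : ℝ)) : ℂ) * (((β * (L : ℝ) ^ 2 : ℝ) : ℂ) * propCT L M β μ K p)) *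
              ((((deriv (fun Λ' : ℝ => hubbardCutoffWeightCT L M β μ K Λ' p') (klScale klE0 n + t * (klScale klE0 (n + 1) - klScale klE0 n)) : ℝ)) : ℂ) *
                (((β * (L : ℝ) ^ 2 : ℝ) : ℂ) * propCT L M β μ K p')) +
            ((((deriv (fun Λ' : ℝ => hubbardCutoffWeightCT L M β μ K Λ' p) (klScale klE0 n + t * (klScale klE0 (n + 1) - klScale klE0 n)) : ℝ)) : ℂ) *
                (((β * (L : ℝ) ^ 2 : ℝ) : ℂ) * propCT L M β μ K p)) *
              ((((softSymbolCompl L M β μ K (n + 1) j p' - softSymbolCompl L M β μ K (n + 1) j' p' : ℝ)) : ℂ) * (((β * (L : ℝ) ^ 2 : ℝ) : ℂ) * propCT L M β μ K p'))‖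
        else 0) ≤
      256 / 3 * (27 / (8 * π ^ 2)) * klTS * (16 * (klScale klE0 j' / klScale klE0 n)) / π * (10 + 50 * (4 + 8 / 3 * R.Gfr 1 * U ^ 2) * β / L) *
        (32 * c ^ 2 * (4 + 8 / 3 * R.Gfr 1 * U ^ 2) ^ 2 * min (klTorusNorm L (x + y - Qm) / klScale klE0 (n + 1)) (klScale klE0 (n + 1) / klTorusNorm L (x + y - Qm)) +
          ((2 : ℝ) ^ n)⁻¹ / 4) :=
  WDx_edge_row_le_slots β μ K twoShellFrameAreaAt_klTS klTS_nonneg hR hU hUu hμ hK hβ n hj' hjj hj'β ht hGδ hE0 Qm x y hc htail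

end Summit.HubbardSuperconductivity.HubbardSuperconductivity.Theorems.KLRegimeSplit

end
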